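import Summits.QuantumAdvantage.QuantumAdvantage.Theses.CubicForrelation
import Summits.QuantumAdvantage.QuantumAdvantage.Theorems.NearExactIsExact.Negative.FifteenSixteenths
import Summits.QuantumAdvantage.QuantumAdvantage.Theorems.NearExactIsExact.Negative.MmPairFixedPoints
import Summits.QuantumAdvantage.QuantumAdvantage.Theorems.NearExactIsExact.Negative.SmallCasesClasses

/-!
# `NearExactIsExact` (stmt-QuantumAdvantage-14043), negative side — the PENTAGON: a bijective two-sided
Maiorana–McFarland cubic pair with `Φ = 15/16` (`n = 20`); CONJECTURE BQQ is false

Disprover seat `b2b-cforr-disprove-g34` (2026-08-23).  HONEST FRAMING: an explicit decidable identity on `𝔽₂¹⁰` and its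
forrelation corollary; it REFUTES the programme's standing conjecture BQQ (seat DISPROOF.md §9.3, quoted in the docstring of
`Negative/MmPairFixedPoints.lean`: "the code `RM(3,m) + RM(3,m)∘τ` has minimum distance `2^{m-4}` for every quadratic
permutation `τ` of `𝔽₂^m` with quadratic inverse", verified there for `3170 + 500` sampled `τ`, `m ≤ 9`, and a theorem at
`m = 7`, `Negative/BqqSeven.lean`) at `m = 10`, and it puts the *bijective* Maiorana–McFarland class at the value `15/16`
(previously reached only with `τ ∘ π ≠ id`, `Negative/FifteenSixteenths.lean`, `n = 16`).  It is NOT a violation of the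
crux (`15/16` is the known lower bound for any admissible `θ`), and not summit progress.

**The pentagon.** Index `𝔽₂¹⁰` by the five vertices `v ∈ ℤ/5` (coordinates `0..4`) and the five edges `{v, v+1}`
(coordinate `5 + v`) of a 5-cycle.  `pent (x) = (x_v ; x_{5+v} ⊕ x_v x_{v+1})` is a quadratic involution of `𝔽₂¹⁰`
(`pent_pent`), and with the cubic `pc (x) = ⊕_v x_v · x_{e(v+1,v+2)} · x_{e(v+3,v+4)}` (each vertex times the unique pair of
disjoint edges of the 5-cycle avoiding it)

  `pc (x) ⊕ pc (pent x) = x₀ x₁ x₂ x₃ x₄`                                   (`pentagon_identity`, `decide`, 1024 cases),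

the indicator of the codimension-5 flat `{x₀ = … = x₄ = 1}` (weight `32 = 2^{10-5}`).  Hence the word `pc ⊕ pc ∘ pent` of the
code `RM(3,10) + RM(3,10)∘pent` has weight `2^{m-5}`, half of BQQ's predicted minimum; and for the Maiorana–McFarland pair
`g20 (y′‖y″) = y′·pent(y″) ⊕ pc(y″)`, `f20 (x′‖x″) = x″·pent(x′) ⊕ pc(x′)` (both cubic, `isDegLeFun_g20/f20`) the tree's
fixed-point formula `MmPairFixedPoints.forrelation_mmPair_of_leftInverse` gives `Φ(f20, g20) = (1024 - 2·32)/1024 = 15/16`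
(`forrelation_f20_g20`).

Provenance (seat folder, `code/disprove-g34/design5.py`, `pentlift.py`): found by solving the LINEAR design conditions for
one-level triangular maps `(b, e ⊕ q(b))` with single-monomial `q`; no such design exists with `≤ 4` extra coordinates, and the
`k = 5` solutions are exactly the twelve labelled 5-cycles.  The seat also shows (paper + machine, DISPROOF §43.5) that this
configuration does NOT lift to a `31/32` pair on `22` bits through an affine component (its adjacent exact partners are
classified by the dihedral stabiliser `D₅`; none passes the exact test), so it is not a route to `Φ ∈ (15/16, 1)` by itself.
Everything below is a theorem; `decide` is used only on `Fin 10 → Bool` (1024 points); axioms are the standard three.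
-/

set_option linter.dupNamespace false -- D-0017: single-problem summit ⇒ `QuantumAdvantage.QuantumAdvantage` by design

noncomputable section

namespace Summit.QuantumAdvantage.QuantumAdvantage.Theorems.NearExactIsExact.Negative.PentagonFifteenSixteenths

open Finset
open Literature.Computability.QuantumComplexity
open Summit.QuantumAdvantage.QuantumAdvantage.Theorems.NearExactIsExact.Negative
  (IsDegLeFun.bxor' IsDegLeFun.band' isDegLeFun_coord isDegLeFun_coord₂)
open Summit.QuantumAdvantage.QuantumAdvantage.Theorems.NearExactIsExact.Negative.MmPairFixedPoints
  (forrelation_mmPair_of_leftInverse)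
open Summit.QuantumAdvantage.QuantumAdvantage.Theorems.NearExactIsExact.Negative.SmallCases (bdot twist_eq_signOf_bdot)

/-- Points of `𝔽₂¹⁰`: coordinates `0..4` = vertices of the pentagon, `5+v` = the edge `{v, v+1 mod 5}`. -/
abbrev X := Fin 10 → Bool

/-- The pentagon involution `pent(x) = (x_v ; x_{5+v} ⊕ x_v·x_{v+1})`. -/
def pent (x : X) : X :=
  ![x 0, x 1, x 2, x 3, x 4, x 5 ^^ (x 0 && x 1), x 6 ^^ (x 1 && x 2), x 7 ^^ (x 2 && x 3), x 8 ^^ (x 3 && x 4),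
    x 9 ^^ (x 4 && x 0)]

/-- The pentagon cubic `pc(x) = ⊕_v x_v · x_{e(v+1,v+2)} · x_{e(v+3,v+4)}` (edge `e(w,w+1)` = coordinate `5+w`). -/
def pc (x : X) : Bool :=
  (x 0 && (x 6 && x 8)) ^^ (x 1 && (x 7 && x 9)) ^^ (x 2 && (x 8 && x 5)) ^^ (x 3 && (x 9 && x 6)) ^^ (x 4 && (x 5 && x 7))

/-- The indicator of the codimension-5 flat `{x₀ = x₁ = x₂ = x₃ = x₄ = 1}`. -/
def flat5 (x : X) : Bool := x 0 && x 1 && x 2 && x 3 && x 4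

set_option maxRecDepth 200000 in
/-- `pent` is an involution (so a permutation equal to its own inverse, both quadratic). [folklore] -/
theorem pent_pent : ∀ x : X, pent (pent x) = x := by decide

set_option maxRecDepth 200000 in
/-- **The pentagon identity** `pc ⊕ pc ∘ pent = 1_{x₀=…=x₄=1}`: a cubic whose composition with the biquadratic `pent` is at
distance `2^{10-5}` from `RM(3,10)` — CONJECTURE BQQ fails at `m = 10`. [folklore] -/
theorem pentagon_identity : ∀ x : X, (pc x ^^ pc (pent x)) = flat5 x := by decide

/-! ### The Maiorana–McFarland pair on `10 + 10` bits -/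

/-- First half of a 20-bit vector. -/
def fst (x : Fin (10 + 10) → Bool) : X := fun i => x (Fin.castAdd 10 i)

/-- Second half of a 20-bit vector. -/
def snd (x : Fin (10 + 10) → Bool) : X := fun i => x (Fin.natAdd 10 i)

/-- The 10-term inner product `u · v` (right-nested xor, definitionally `SmallCases.bdot 10`). -/
def dot10 (u v : X) : Bool :=
  xor (u 0 && v 0) (xor (u 1 && v 1) (xor (u 2 && v 2) (xor (u 3 && v 3) (xor (u 4 && v 4)
    (xor (u 5 && v 5) (xor (u 6 && v 6) (xor (u 7 && v 7) (xor (u 8 && v 8) (xor (u 9 && v 9) false)))))))))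

/-- `g20(y′‖y″) = y′·pent(y″) ⊕ pc(y″)` (Maiorana–McFarland, bent, cubic). -/
def g20 (y : Fin (10 + 10) → Bool) : Bool := xor (dot10 (fst y) (pent (snd y))) (pc (snd y))

/-- `f20(x′‖x″) = x″·pent(x′) ⊕ pc(x′)` (the same shape on the swapped halves). -/
def f20 (x : Fin (10 + 10) → Bool) : Bool := xor (dot10 (snd x) (pent (fst x))) (pc (fst x))

/-- The first half of `a ++ b` is `a`. [folklore] -/
@[simp] theorem fst_append (a b : X) : fst (Fin.append a b) = a := by
  funext i; exact Fin.append_left a b i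

/-- The second half of `a ++ b` is `b`. [folklore] -/
@[simp] theorem snd_append (a b : X) : snd (Fin.append a b) = b := by
  funext i; exact Fin.append_right a b i

/-- `(-1)^{u·v}` is the twist. [folklore] -/
theorem signOf_dot10 (u v : X) : signOf (dot10 u v) = twist u v := by
  rw [twist_eq_signOf_bdot]
  rfl

/-- `g20` is cubic (structural bookkeeping: coordinates `1`, `1+1 ≤ 2`, `1+2 ≤ 3`). [folklore] -/
theorem isDegLeFun_g20 : IsDegLeFun 3 g20 := by
  unfold g20 dot10 fst snd pent pc
  simp only [Matrix.cons_val_zero, Matrix.cons_val_one, Matrix.cons_val]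
  repeat (first
      | exact isDegLeFun_coord _
      | exact isDegLeFun_coord₂ _
      | exact isDegLeFun_const _ _
      | apply IsDegLeFun.bxor'
      | apply IsDegLeFun.band' (a := 1) (b := 1) (d := 2) _ _ (by norm_num)
      | apply IsDegLeFun.band' (a := 1) (b := 2) (d := 3) _ _ (by norm_num))

/-- `f20` is cubic. [folklore] -/
theorem isDegLeFun_f20 : IsDegLeFun 3 f20 := by
  unfold f20 dot10 fst snd pent pc
  simp only [Matrix.cons_val_zero, Matrix.cons_val_one, Matrix.cons_val]
  repeat (first
      | exact isDegLeFun_coord _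
      | exact isDegLeFun_coord₂ _
      | exact isDegLeFun_const _ _
      | apply IsDegLeFun.bxor'
      | apply IsDegLeFun.band' (a := 1) (b := 1) (d := 2) _ _ (by norm_num)
      | apply IsDegLeFun.band' (a := 1) (b := 2) (d := 3) _ _ (by norm_num))

/-- `pc` is cubic. [folklore] -/
theorem isDegLeFun_pc : IsDegLeFun 3 pc := by
  unfold pc
  repeat (first
      | exact isDegLeFun_coord _
      | exact isDegLeFun_coord₂ _
      | apply IsDegLeFun.bxor'
      | apply IsDegLeFun.band' (a := 1) (b := 1) (d := 2) _ _ (by norm_num)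
      | apply IsDegLeFun.band' (a := 1) (b := 2) (d := 3) _ _ (by norm_num))

/-- Every coordinate of `pent` is quadratic (so `pent` is a quadratic permutation with quadratic inverse — itself). [folklore] -/
theorem isDegLeFun_pent : ∀ j : Fin 10, IsDegLeFun 2 (fun x : X => pent x j) := by
  rw [Fin.forall_fin_succ, Fin.forall_fin_succ, Fin.forall_fin_succ, Fin.forall_fin_succ, Fin.forall_fin_succ,
    Fin.forall_fin_succ, Fin.forall_fin_succ, Fin.forall_fin_succ, Fin.forall_fin_succ, Fin.forall_fin_one]
  unfold pent
  simp only [Matrix.cons_val_zero, Matrix.cons_val_succ, Matrix.cons_val_fin_one]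
  refine ⟨?_, ?_, ?_, ?_, ?_, ?_, ?_, ?_, ?_, ?_⟩ <;>
  · repeat (first
        | exact isDegLeFun_coord₂ _
        | exact isDegLeFun_coord _
        | apply IsDegLeFun.bxor'
        | apply IsDegLeFun.band' (a := 1) (b := 1) (d := 2) _ _ (by norm_num))

/-! ### The value -/

/-- Sign form of `g20`. [folklore] -/
theorem signOf_g20 (y₁ y₂ : X) : signOf (g20 (Fin.append y₁ y₂)) = twist y₁ (pent y₂) * signOf (pc y₂) := by
  rw [g20, fst_append, snd_append, signOf_xor, signOf_dot10]

/-- Sign form of `f20`. [folklore] -/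
theorem signOf_f20 (x₁ x₂ : X) : signOf (f20 (Fin.append x₁ x₂)) = twist x₂ (pent x₁) * signOf (pc x₁) := by
  rw [f20, fst_append, snd_append, signOf_xor, signOf_dot10]

/-- The flat `{x₀=…=x₄=1}` has `32` of the `1024` points. [folklore] -/
theorem sum_flat5 : ∑ x : X, (if flat5 x = true then (1 : ℝ) else 0) = 32 := by
  have e : ∀ z : Fin (5 + 5) → Bool, (if flat5 z = true then (1 : ℝ) else 0) =
      (if (fun i : Fin 5 => z (Fin.castAdd 5 i)) = ![true, true, true, true, true] then (1 : ℝ) else 0) := by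
    intro z
    refine if_congr ?_ rfl rfl
    rw [funext_iff, Fin.forall_fin_succ, Fin.forall_fin_succ, Fin.forall_fin_succ, Fin.forall_fin_succ, Fin.forall_fin_one]
    simp only [flat5, Matrix.cons_val_zero, Matrix.cons_val_succ, Matrix.cons_val_fin_one, Bool.and_eq_true]
    constructor
    · rintro ⟨⟨⟨⟨h0, h1⟩, h2⟩, h3⟩, h4⟩; exact ⟨h0, h1, h2, h3, h4⟩
    · rintro ⟨h0, h1, h2, h3, h4⟩; exact ⟨⟨⟨⟨h0, h1⟩, h2⟩, h3⟩, h4⟩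
  rw [show (∑ x : X, if flat5 x = true then (1 : ℝ) else 0) =
      ∑ z : Fin (5 + 5) → Bool, if flat5 z = true then (1 : ℝ) else 0 from rfl]
  rw [Finset.sum_congr rfl fun z _ => e z, sum_append]
  simp only [Fin.append_left]
  have e2 : ∀ a : Fin 5 → Bool, (∑ _b : Fin 5 → Bool, if (fun i => a i) = ![true, true, true, true, true] then (1 : ℝ) else 0)
      = if a = ![true, true, true, true, true] then (32 : ℝ) else 0 := by
    intro a
    rw [sum_const, card_univ, Fintype.card_fun, Fintype.card_bool, Fintype.card_fin, nsmul_eq_mul]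
    split_ifs <;> norm_num
  rw [Finset.sum_congr rfl fun a _ => e2 a, Finset.sum_ite_eq' univ, if_pos (mem_univ _)]

/-- `∑_x (-1)^{pc(x) ⊕ pc(pent x)} = 1024 - 2·32 = 960`. [folklore] -/
theorem sum_sign_residual : ∑ x : X, signOf (pc x) * signOf (pc (pent x)) = 960 := by
  have e : ∀ x : X, signOf (pc x) * signOf (pc (pent x)) = 1 - 2 * (if flat5 x = true then (1 : ℝ) else 0) := by
    intro x
    rw [← signOf_xor, pentagon_identity x]
    cases flat5 x <;> simp [signOf]; norm_num
  rw [Finset.sum_congr rfl fun x _ => e x, sum_sub_distrib, ← mul_sum, sum_flat5, sum_const, card_univ,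
    Fintype.card_fun, Fintype.card_bool, Fintype.card_fin]
  norm_num

/-- **The pentagon pair has `Φ = 15/16`** — a bijective (`τ ∘ π = id`, here `τ = π = pent`) two-sided Maiorana–McFarland
cubic pair beyond `7/8`, refuting CONJECTURE BQQ. [folklore] -/
theorem forrelation_f20_g20 : forrelation f20 g20 = 15 / 16 := by
  rw [forrelation_mmPair_of_leftInverse f20 g20 pent pent pc pc signOf_g20 signOf_f20 pent_pent, sum_sign_residual]
  norm_num

/-- Packaged: an explicit cubic pair on `20` bits, both in Maiorana–McFarland form over the SAME quadratic involution, with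
`Φ = 15/16 ∈ (7/8, 1)`. [folklore] -/
theorem exists_bijectiveMm_pair_fifteen_sixteenths :
    ∃ f g : (Fin (10 + 10) → Bool) → Bool, IsDegLeFun 3 f ∧ IsDegLeFun 3 g ∧ forrelation f g = 15 / 16 :=
  ⟨f20, g20, isDegLeFun_f20, isDegLeFun_g20, forrelation_f20_g20⟩

end Summit.QuantumAdvantage.QuantumAdvantage.Theorems.NearExactIsExact.Negative.PentagonFifteenSixteenths
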